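import Literature.Computability.AlgebraicComplexity.RectangularExponent
import Literature.Computability.AlgebraicComplexity.SchonhageRectangular
import Literature.Computability.AlgebraicComplexity.AsymptoticRankMultiples
import Literature.Computability.AlgebraicComplexity.BigCoppersmithWinogradProofs
import HarnessLib

/-!
# The 2025 rectangular records `advxxz2025_omegaRect_table`: reduction to the paper's laser-method certificate

Topic `Literature/Computability/AlgebraicComplexity`; companion of `RectangularExponent.lean`, whose
named fact `advxxz2025_omegaRect_table` — Table 1 of Alman–Duan–Vassilevska Williams–Xu–Xu–Zhou,
*More asymmetry yields faster matrix multiplication* (SODA 2025, arXiv:2404.16349): `ω(1,k,1) ≤ b`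
for the 13 printed rows `(k, b)`, including `ω ≤ 2.371339` and `μ ≤ 0.5275` — is the current world
record, obtained by the laser method with (more) asymmetric hashing on `CW_5^{⊗4}` and a numerical
solution (SNOPT) of a non-convex constraint program (§7; code and parameters at osf.io/mw5ak).

The printed proof has three layers (paper §3.2–§3.6 and §7, "Procedure of degeneration"):

1. `R̃(CW_q) ≤ q + 2` (Coppersmith–Winograd 1990; §3.6) — PROVED in the tree:
   `asymptoticRank_bigCwTensor_le` (`BigCoppersmithWinogradProofs.lean`: `bR(CW_q) ≤ q+2` and `R̃ ≤ bR`);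
2. Schönhage's asymptotic sum inequality for `ω(1,k,1)` (Thm. 3.2) — PROVED in the tree:
   `mul_rpow_omegaRect_mid_le_asymptoticRank` (`SchonhageRectangular.lean`);
3. the paper's own content: a DEGENERATION of `2^{o(n)}` independent copies of
   `(CW_5^{⊗4})^{⊗n}` into `V` independent copies of a matrix multiplication tensor `⟨A, B, C⟩`
   (global stage §5, constituent stage §6, hole fixing [VXXZ24, Cor. 3.2]; all steps are stated as
   degenerations, §3.3) whose parameters, found numerically (§7, Table 1), satisfy the printed
   limiting condition `lim_{ε→0} lim_{n→∞} V^{1/n} · min{A, B^{1/κ}, C}^{ω'/n} ≥ (q+2)^{2^{ℓ*−1}} = 7^4`.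

Layer 3 is vendored here as a named fact, `advxxz2025_laserDegeneration`, through the table-indexed
predicate `CW5DegenerationCertificate` (the `δ`-form in which the limiting condition is used: for
every `δ > 0` some instance has `t · 7^N ≤ V · a^{b+δ}`), with degeneration = `PolyDegeneratesTo` of
`UniversalMethodBarrier.lean` (Alman 2021 §2.4 = the paper's §3.3: `𝔽[λ]`-linear maps and
`λ^{-d}(…) + O(λ)`), `CW_5 = bigCwTensor ℂ 5`, copies `⟨t⟩ ⊗ ·`; and the table is DERIVED from it:
`advxxz2025_omegaRect_table_of_laserDegeneration` (proved from layers 1–2, `R̃` monotone under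
degeneration, `R̃(⟨t⟩ ⊗ T^{⊗N}) ≤ t R̃(T)^N`).  Discharging `advxxz2025_laserDegeneration` would
require formalising the asymmetric-hashing laser method (§4–§6: Thm 5.3 global stage, Thm 6.2/6.4
constituent stage, Thm 4.2 hole fixing, Lemma 5.5 hashing, Thm 3.7 Salem–Spencer) as a parametric
theorem "program (7.1) feasible at `(κ, ω')` ⇒ `CW5DegenerationCertificate [(κ, ω')]`" (layer T,
thousands of lines of unformalised combinatorics; the honest trust base of `ω ≤ 2.371339`).  Its
numerical hypothesis (layer C) is no longer the obstacle: the audit below exhibits, for every row,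
an EXACT rational feasible point of the published program with objective below the printed bound,
checked in interval arithmetic.  The 2024 table (`vxxz2024_omegaRect_table`, same pipeline,
VXXZ 2024 §3–§8) reduces to `CW5DegenerationCertificate vxxz2024Table` by the same theorem
`omegaRect_le_of_cw5DegenerationCertificate`.

## The published artifact (layer 3, part C: the numerical solution)

§7: "The code and the sets of parameters are available at https://osf.io/mw5ak" — one archive
`code_matrix_mult.zip` (2 453 673 bytes, sha256
`a88d211df0a82f0bba0a77ccbad9103064ebef08eea95613e5926a4f666260d8`, OSF timestamp 2024-04-29):
`README.md`, `Script.m`, the MATLAB/SNOPT sources `src/{evaluation,autograd,optimizer,verify,…}` and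
14 parameter files `data/W<κ>_<ω'>.mat` (one per row of Table 1, e.g. `data/W1.00_2.371339.mat`)
and `data/Mu_0.527499.mat`, each a single IEEE-double vector `params` of length 24 855 (entry 20 =
the objective `ω'`, entry 21 = `κ`).  The verifier (`src/verify/VerifyOmega.m`, `GetFeasibility.m`)
evaluates the nonlinear/linear (in)equality constraints of `src/evaluation/Workspace.m` — whose only
constraint involving `ω'` is the log-form of the limiting condition above,
`single_mat_size · ω' + Σ_r num_retain_glob{r} + Σ_{r,ℓ} num_retain_comp{r}{ℓ} ≥ 2^{ℓ*−1} log(q+2)`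
with `single_mat_size ≤ min(mat_size₁, mat_size₂, mat_size₃ / κ)` — and accepts at maximal
violation `≤ 1.1·10⁻⁶` ("accurate" at `≤ 1.1·10⁻⁹`); a floating-point feasibility check, not an
exact certificate.

Audit (harness compute-cert session 2026-08-15, unit
`compute-cert-Literature.Computability.AlgebraicComple-664068eaed`; folder evidence `ESTIMATE.md`,
`job/out_full/{report.txt,summary.json,manifest.json}`; scripts `job/advxxz_verify.py` /
`job/main.py`, sha256 `b55c04108f16a7b6bb02b2c8f806c9ad8f3c6071a888e1afc68f5d2a7325f168` /
`4603a243b7f21b0850c53d1689df63385c93c644c3e7a705ced9e60c2d6eeaab`, pure Python 3 + mpmath 1.3.0,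
70 s on one core; inputs = the 14 `data/*.mat` members of the archive, sha256-identical to the zip
members).
(F) An independent line-by-line Python port (values only) of
`src/{evaluation,autograd,utils,complete_split,verify}` rebuilds the program for `q = 5`, `ℓ* = 3` —
exactly the 24 855 parameters (8 860 groups; 270 level-3 terms = 126 `TermInfo` + 144
`TermInfoZero`; 5 508 level-2 terms), 43 nonlinear inequalities, 5 778 Lagrange + 5 auxiliary
equalities, 8 653 linear equalities, boxes — and reproduces the authors' `Script.m` output
(`img/screenshot.png` in the archive) to all 7 printed digits on all 14 files: maximal violation
between `9.6·10⁻¹³` (κ = 0.5) and `7.8·10⁻¹⁰` (κ = 0.9; κ = 1: `1.137411·10⁻¹⁰`), so every file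
passes at the authors' "accurate" `1.1·10⁻⁹` level; in every file all 43 inequalities are active
(`|slack| ≤ 4.3·10⁻¹⁰`), linear equalities hold to `4.5·10⁻¹¹`, and stored parameters leave their
boxes by at most `3.3·10⁻¹¹` (clamped by the verifier, `ParamManager.SetValue`).
(R) Rigorous re-evaluation: from each stored vector an exact rational point is formed (clamp into
the box, renormalise every distribution to sum exactly 1, `κ :=` the table's rational), every
auxiliary `min`-variable is replaced by the exact minimum it abbreviates, and every max-entropy
penalty `H(dist_max) − H(α)` by `D(λ; m) − H(α)` with the weak-duality bound
`D(λ; m) = Σ_t e^{L_t − 1} − (⟨λ, m⟩ + λ_S) ≥ max {H(α') : α' ≥ 0 with marginals m}`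
(`L_t = λ_X(i_t) + λ_Y(j_t) + λ_Z(k_t) + λ_S`; from `−x log x ≤ e^{y−1} − xy`) at the stored
multipliers (which are near-optimal: `D − H(dist_max) ≤ 3.2·10⁻¹⁰` over the 762 penalty terms of
every file) — sound because a penalty only lowers a retained-triple count, and it removes
`dist_max` together with all Lagrange and marginal-sharing equalities — after which the smallest
`ω'` satisfying the final constraint,
`ω* = (4 log 7 − Σ retains) / min(mat_size₁, mat_size₂, mat_size₃ / κ)`,
is enclosed in interval arithmetic (mpmath `iv`, 30 digits; widths `≤ 4·10⁻²⁸`).  Result: every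
row of Table 1 is supported by an exactly feasible point, `ω* < b` with margins `b − ω*` from
`9.9·10⁻⁸` (κ = 1) to `1.4·10⁻⁶` (κ = 0.7); the printed entries are the 6-decimal round-ups of the
stored objectives, and `ω*` exceeds the stored `ω'` by at most `3.9·10⁻¹⁰` (the inequality
residuals pushed into the objective) —

| `κ` | stored `ω'` | maxViol (F) | `ω*` (R, rounded up) | printed `b` |
|---|---|---|---|---|
| 0.33 | 2.000091498968 | 3.2·10⁻¹¹ | 2.000091498995 | 2.000092 |
| 0.34 | 2.000519720683 | 4.5·10⁻¹¹ | 2.000519720737 | 2.000520 |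
| 0.35 | 2.001242176256 | 4.5·10⁻¹¹ | 2.001242176293 | 2.001243 |
| 0.40 | 2.009279412539 | 4.4·10⁻¹¹ | 2.009279412543 | 2.009280 |
| 0.50 | 2.042775378836 | 9.6·10⁻¹³ | 2.042775378839 | 2.042776 |
| 0.5275 | 2.054998583183 | 4.5·10⁻¹¹ | 2.054998583210 | 2.054999 |
| 0.60 | 2.092350255997 | 8.5·10⁻¹¹ | 2.092350256139 | 2.092351 |
| 0.70 | 2.152768630516 | 4.4·10⁻¹¹ | 2.152768630525 | 2.152770 |
| 0.80 | 2.220638360332 | 4.4·10⁻¹¹ | 2.220638360354 | 2.220639 |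
| 0.90 | 2.293940368515 | 7.8·10⁻¹⁰ | 2.293940368898 | 2.293941 |
| 1.00 | 2.371338900543 | 1.1·10⁻¹⁰ | 2.371338900718 | 2.371339 |
| 1.50 | 2.794632838052 | 5.7·10⁻¹⁰ | 2.794632838139 | 2.794633 |
| 2.00 | 3.250034054206 | 4.5·10⁻¹¹ | 3.250034054252 | 3.250035 |
| μ | `κ' = 0.527498894680`, `ω' = 1 + 2κ'` | 4.5·10⁻¹¹ | `1 + 2κ' + 1.1·10⁻¹¹` | `μ ≤ 0.5275` |

(so, unlike Table 1 of VXXZ 2024 — `RectangularExponentCert.lean` — no row is printed below what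
its parameters support; for the `μ` file the residual transfers to `μ ≤ κ' + 1.1·10⁻¹¹ < 0.527499`
because `k ↦ ω(1,k,1) − 2k` is non-increasing, and row `κ = 0.5275` gives `μ ≤ 0.5275` directly,
`2.054999 < 2.055`).  What (F)+(R) do not touch is layer T: that feasibility of this program
implies the degeneration.

## References

* J. Alman, R. Duan, V. Vassilevska Williams, Y. Xu, Z. Xu, R. Zhou, *More asymmetry yields faster
  matrix multiplication*, SODA 2025, arXiv:2404.16349v2: §1 Table 1; §3.2 (degenerations; `R̃`
  monotone), §3.3–§3.4 (Thm. 3.2), §3.6 (`R̃(CW_q) ≤ q+2`); §7 "Numerical Result" (procedure of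
  degeneration, its limiting condition; "All these bounds were derived by analyzing `CW_5^{⊗4}`";
  "we showed that `ω ≤ 2.371339` and `μ ≤ 0.527500`"). [AlmanDuanVassilevskaWilliamsXuXuZhou2025]
* V. Vassilevska Williams, Y. Xu, Z. Xu, R. Zhou, *New bounds for matrix multiplication: from alpha
  to omega*, SODA 2024, Cor. 3.2 (fixing holes), §8. [VassilevskaWilliamsXuXuZhou2024]
-/

noncomputable section

open scoped BigOperators

namespace Literature.Computability.AlgebraicComplexity

open Literature.Barriers.MatrixMultiplication

/-! ## Laser-method degeneration certificates on `CW_5` -/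

/-- **A laser-method degeneration certificate on `CW_5` for a table of rectangular bounds**: for
every row `(k, b)` of `T` and every `δ > 0` there are `N ≥ 1`, `t ≥ 1` (initial independent copies,
the papers' `2^{o(n)}`), `V ≥ 1`, `a ≥ 2` and an integer `B ≥ a^k` such that `t` independent copies
of `CW_5^{⊗N}` DEGENERATE into `V` independent copies of `⟨a, B, a⟩`, with `t · 7^N ≤ V · a^{b+δ}`.
This is the output format of the laser method on powers of `CW_5` (ADVXXZ 2025, §7, "Procedure of
degeneration": a degeneration of `2^{o(n)}` copies of `CW_5^{⊗4n}` into `V` copies of `⟨A,B,C⟩`,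
restricted to `a = min{A, ⌊B^{1/k}⌋, C}`), and the numerical inequality is the `δ`-form of its
printed limiting condition `lim_{ε→0} lim_{n→∞} V^{1/n} min{A, B^{1/κ}, C}^{ω'/n} ≥ 7^4` with
`ω' = b`.  Degeneration is `PolyDegeneratesTo` (the paper's §3.3), `CW_5 = bigCwTensor ℂ 5`.
[cite: AlmanDuanVassilevskaWilliamsXuXuZhou2025, §7 (procedure of degeneration and its limiting condition)] -/
def CW5DegenerationCertificate (T : List (ℝ × ℝ)) : Prop :=
  ∀ k b : ℝ, (k, b) ∈ T → ∀ δ : ℝ, 0 < δ →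
    ∃ N t V a B : ℕ, 1 ≤ N ∧ 1 ≤ t ∧ 1 ≤ V ∧ 2 ≤ a ∧ (a : ℝ) ^ k ≤ B ∧
      PolyDegeneratesTo (kroneckerTensor (unitTensor ℂ t) (kroneckerPow (bigCwTensor ℂ 5) N))
        (kroneckerTensor (unitTensor ℂ V) (matMulTensor ℂ a B a)) ∧
      (t : ℝ) * 7 ^ N ≤ (V : ℝ) * (a : ℝ) ^ (b + δ)

/-- **The ADVXXZ 2025 laser-method degeneration** (the computer-assisted content of Alman–Duan–
Vassilevska Williams–Xu–Xu–Zhou 2025: §4–§6, the asymmetric-hashing laser method on `CW_5^{⊗4}`,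
and §7, the SNOPT solution of its constraint program for the 13 values of `κ` of Table 1): the
degeneration certificate `CW5DegenerationCertificate` holds for every row of Table 1
(`advxxz2025Table`).  Named fact (statement only); it implies the printed Table 1
(`advxxz2025_omegaRect_table_of_laserDegeneration`).
[cite: AlmanDuanVassilevskaWilliamsXuXuZhou2025, §7 and §1 Table 1] -/
def advxxz2025_laserDegeneration : Prop :=
  CW5DegenerationCertificate advxxz2025Table

/-! ## From a certificate to the exponent bounds -/

/-- `R̃(⟨t⟩ ⊗ CW_5^{⊗N}) ≤ t · 7^N` for `N ≥ 1` (`R̃` of copies, of powers, and `R̃(CW_5) ≤ 7`).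
[cite: AlmanDuanVassilevskaWilliamsXuXuZhou2025, §3.2 and §3.6] -/
theorem asymptoticRank_multiple_bigCw_pow_le {N : ℕ} (hN : 1 ≤ N) (t : ℕ) :
    asymptoticRank (kroneckerTensor (unitTensor ℂ t) (kroneckerPow (bigCwTensor ℂ 5) N)) ≤
      (t : ℝ) * 7 ^ N := by
  refine (asymptoticRank_multiple_le ℂ t _).trans ?_
  have h7 : asymptoticRank (bigCwTensor ℂ 5) ≤ 7 := by
    have h := asymptoticRank_bigCwTensor_le ℂ 5
    norm_num at h
    exact h
  have hpow : asymptoticRank (kroneckerPow (bigCwTensor ℂ 5) N) ≤ 7 ^ N :=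
    (asymptoticRank_kroneckerPow_le _ hN).trans
      (pow_le_pow_left₀ (asymptoticRank_nonneg _) h7 N)
  gcongr

/-- **A `CW_5` degeneration certificate proves its table**: for every certified row `(k, b)` with
`k ≥ 0`, `ω(1, k, 1) ≤ b` over `ℂ` — layers 1–2 of the printed proofs
(`V a^{ω(1,k,1)} ≤ R̃(⟨V⟩ ⊗ ⟨a,B,a⟩) ≤ R̃(⟨t⟩ ⊗ CW_5^{⊗N}) ≤ t 7^N ≤ V a^{b+δ}`, so
`ω(1,k,1) ≤ b + δ` for every `δ > 0`). [cite: AlmanDuanVassilevskaWilliamsXuXuZhou2025, §7] -/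
theorem omegaRect_le_of_cw5DegenerationCertificate {T : List (ℝ × ℝ)}
    (hT : CW5DegenerationCertificate T) {k b : ℝ} (hkb : (k, b) ∈ T) (hk : 0 ≤ k) :
    omegaRect ℂ 1 k 1 ≤ b := by
  refine le_of_forall_pos_lt_add fun δ hδ => ?_
  obtain ⟨N, t, V, a, B, hN, ht, hV, ha, haB, hdeg, hnum⟩ := hT k b hkb (δ / 2) (half_pos hδ)
  have ha1 : (1 : ℝ) < a := by exact_mod_cast (by omega : 1 < a)
  have hV0 : (0 : ℝ) < V := by exact_mod_cast (by omega : 0 < V)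
  have h1 := mul_rpow_omegaRect_mid_le_asymptoticRank ℂ hk hV ha haB
  have h2 := asymptoticRank_le_of_polyDegeneratesTo hdeg
  have h3 := asymptoticRank_multiple_bigCw_pow_le hN t
  have hchain : (V : ℝ) * (a : ℝ) ^ omegaRect ℂ 1 k 1 ≤ (V : ℝ) * (a : ℝ) ^ (b + δ / 2) :=
    h1.trans (h2.trans (h3.trans hnum))
  have h4 : (a : ℝ) ^ omegaRect ℂ 1 k 1 ≤ (a : ℝ) ^ (b + δ / 2) := le_of_mul_le_mul_left hchain hV0
  have h5 : omegaRect ℂ 1 k 1 ≤ b + δ / 2 := (Real.rpow_le_rpow_left_iff ha1).1 h4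
  linarith

/-- All exponents `k` of Table 1 of ADVXXZ 2025 are non-negative (indeed `≥ 0.33`).
[cite: AlmanDuanVassilevskaWilliamsXuXuZhou2025, §1 Table 1] -/
theorem advxxz2025Table_fst_nonneg {k b : ℝ} (h : (k, b) ∈ advxxz2025Table) : 0 ≤ k := by
  simp only [advxxz2025Table, List.mem_cons, Prod.mk.injEq, List.not_mem_nil, or_false] at h
  rcases h with ⟨rfl, -⟩ | ⟨rfl, -⟩ | ⟨rfl, -⟩ | ⟨rfl, -⟩ | ⟨rfl, -⟩ | ⟨rfl, -⟩ | ⟨rfl, -⟩ |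
    ⟨rfl, -⟩ | ⟨rfl, -⟩ | ⟨rfl, -⟩ | ⟨rfl, -⟩ | ⟨rfl, -⟩ | ⟨rfl, -⟩ <;> norm_num

/-- **Table 1 of ADVXXZ 2025 from the paper's laser-method degeneration**: layers 1–2 of the
printed proof (`R̃(CW_5) ≤ 7`, Schönhage's rectangular asymptotic sum inequality) are theorems of
the tree, so the record bounds `ω(1,k,1) ≤ b` (including `ω ≤ 2.371339`) follow from the
degeneration certificate alone. [cite: AlmanDuanVassilevskaWilliamsXuXuZhou2025, §7] -/
theorem advxxz2025_omegaRect_table_of_laserDegeneration (h : advxxz2025_laserDegeneration) :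
    advxxz2025_omegaRect_table := fun _ _ hkb =>
  omegaRect_le_of_cw5DegenerationCertificate h hkb (advxxz2025Table_fst_nonneg hkb)

/-- In particular the laser-method degeneration certifies the square record `ω ≤ 2.371339`
(`advxxz2025_omega_le`). [cite: AlmanDuanVassilevskaWilliamsXuXuZhou2025, §7] -/
theorem advxxz2025_omega_le_of_laserDegeneration (h : advxxz2025_laserDegeneration) :
    advxxz2025_omega_le :=
  (advxxz2025_omegaRect_table_of_laserDegeneration h).omega_le

end Literature.Computability.AlgebraicComplexity

end
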